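import Summits.CriticalPhenomena.PercolationContinuityZ3.Theorems.PercNearOneGluingNoHeavyLowerTailThreePartitionJuntaCert
import Summits.CriticalPhenomena.PercolationContinuityZ3.Theorems.PercNearOneGluingNoHeavyLowerTailThreePartitionJunta3Codes
import Summits.CriticalPhenomena.PercolationContinuityZ3.Theorems.PercNearOneGluingNoHeavyLowerTailThreePartitionJunta3CheckB
import HarnessLib.Audit

/-!
# `NoHeavyLowerTail` (crux stmt-CriticalPhenomena-4575), master-family hierarchy P3 (gen 37): ★ the 3-JUNTA THEOREM —
# `threePartNT τ 𝒰 A B ≥ 0` for EVERY increasing event `𝒰` depending on three coordinates, ALL increasing `A, B`, every twist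

Support file (seat `prim-masterthm-p3`; `--supports stmt-CriticalPhenomena-4575`; memo
`run/shared/lean/prim/prim-masterthm/FROM-prim-masterthm-p3-g37-ONE-DISJUNCTION.md` §8).  The SIGNATURE METHOD (`…ThreePartitionJuntaCert`:
a pure diagonal Kleitman certificate on the block `Q` ⇒ positivity on every ground set) discharged for `|Q| = 3`: the certificates for all
20 monotone Boolean functions of three variables and all 8 twists of the block are the table `CERT3` of `…ThreePartitionJunta3Check`, whose
conditions were evaluated in the kernel (`checkT_all`).  Codes and transport are in `…ThreePartitionJunta3Codes`.  Here: masks of up-sets (`exists_mask`), evaluation of the three pattern forms at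
coded data (`sum_cJ_eq`, `sum_kappa_eq`, `sum_eJ_eq`), soundness `diagCert_of_checkOne`, and
  `threePartNT_junta3_nonneg : p, q, r distinct → IsUpperSet 𝔘 → 0 ≤ threePartNT τ (liftQ {p,q,r} 𝔘) A B`   (all up-sets `A, B`, every `τ`),
`threePartNT_nonneg_of_junta3` (any slot; events DETERMINED by `{p,q,r}`), and the example `threePartNT_maj3_nonneg` (majority of three).
This contains the one-disjunction, principal and nested classes restricted to three coordinates and every other monotone function of three
coins (`p∧(q∨r)`, `p∨(q∧r)`, `MAJ₃`, …).  The same certificates exist (LP, verified exactly) for `|Q| ≤ 5` (memo §8); their kernel discharge needs a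
faster evaluator.  HONEST LABEL: COMB-C3 / twisted three-partition positivity for (3-junta, arbitrary, arbitrary), kernel-checked; the general
conjecture stays OPEN; nothing bears on the (closed) crux. [this work]
-/

noncomputable section

open Finset
open scoped symmDiff

namespace Summit.CriticalPhenomena.PercolationContinuityZ3.Theorems.ThreePartition

open Junta3

variable {ι : Type*} [Fintype ι]

/-! ## Masks of families and the soundness of the finite check -/

section Sound

variable {p q r : ι} (hd : p ≠ q ∧ p ≠ r ∧ q ≠ r)

/-- Every monotone Boolean function of 3 variables is (coded by) a member of `MONO8`. [this work] -/
theorem exists_mono8 : ∀ g₀ g₁ g₂ g₃ g₄ g₅ g₆ g₇ : Bool,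
    (g₀ = true → g₁ = true) → (g₀ = true → g₂ = true) → (g₀ = true → g₄ = true) → (g₁ = true → g₃ = true) →
    (g₁ = true → g₅ = true) → (g₂ = true → g₃ = true) → (g₂ = true → g₆ = true) → (g₄ = true → g₅ = true) →
    (g₄ = true → g₆ = true) → (g₃ = true → g₇ = true) → (g₅ = true → g₇ = true) → (g₆ = true → g₇ = true) →
    ∃ a ∈ MONO8, a.testBit 0 = g₀ ∧ a.testBit 1 = g₁ ∧ a.testBit 2 = g₂ ∧ a.testBit 3 = g₃ ∧ a.testBit 4 = g₄ ∧
      a.testBit 5 = g₅ ∧ a.testBit 6 = g₆ ∧ a.testBit 7 = g₇ := by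
  set_option synthInstance.maxSize 2048 in decide

omit [Fintype ι] in
/-- Classical Boolean membership test. [this work] -/
noncomputable def memB (𝔄 : Set (Set ι)) (m : Set ι) : Bool := @decide (m ∈ 𝔄) (Classical.dec _)

omit [Fintype ι] in
/-- `memB` decides membership. [this work] -/
theorem memB_eq_true_iff (𝔄 : Set (Set ι)) (m : Set ι) : memB 𝔄 m = true ↔ m ∈ 𝔄 := by
  unfold memB; exact @decide_eq_true_iff _ (Classical.dec _)

omit [Fintype ι] in
/-- The trace of an up-set on the 8 subsets of `{p,q,r}` is coded by a monotone mask. [this work] -/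
theorem exists_mask (𝔄 : Set (Set ι)) (h𝔄 : IsUpperSet 𝔄) : ∃ a ∈ MONO8, ∀ c, c < 8 → (a.testBit c = true ↔ dec p q r c ∈ 𝔄) := by
  have hm : ∀ c c' : ℕ, (c.testBit 0 = true → c'.testBit 0 = true) → (c.testBit 1 = true → c'.testBit 1 = true) →
      (c.testBit 2 = true → c'.testBit 2 = true) → memB 𝔄 (dec p q r c) = true → memB 𝔄 (dec p q r c') = true := by
    intro c c' h0 h1 h2 h
    rw [memB_eq_true_iff] at h ⊢
    exact h𝔄 (dec_mono p q r h0 h1 h2) h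
  obtain ⟨a, ha, e0, e1, e2, e3, e4, e5, e6, e7⟩ := exists_mono8 (memB 𝔄 (dec p q r 0)) (memB 𝔄 (dec p q r 1))
    (memB 𝔄 (dec p q r 2)) (memB 𝔄 (dec p q r 3)) (memB 𝔄 (dec p q r 4)) (memB 𝔄 (dec p q r 5))
    (memB 𝔄 (dec p q r 6)) (memB 𝔄 (dec p q r 7))
    (hm 0 1 (by decide) (by decide) (by decide)) (hm 0 2 (by decide) (by decide) (by decide)) (hm 0 4 (by decide) (by decide) (by decide))
    (hm 1 3 (by decide) (by decide) (by decide)) (hm 1 5 (by decide) (by decide) (by decide)) (hm 2 3 (by decide) (by decide) (by decide))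
    (hm 2 6 (by decide) (by decide) (by decide)) (hm 4 5 (by decide) (by decide) (by decide)) (hm 4 6 (by decide) (by decide) (by decide))
    (hm 3 7 (by decide) (by decide) (by decide)) (hm 5 7 (by decide) (by decide) (by decide)) (hm 6 7 (by decide) (by decide) (by decide))
  refine ⟨a, ha, fun c hc => ?_⟩
  rw [← memB_eq_true_iff 𝔄]
  interval_cases c
  exacts [by rw [e0], by rw [e1], by rw [e2], by rw [e3], by rw [e4], by rw [e5], by rw [e6], by rw [e7]]

omit [Fintype ι] in
/-- A mask evaluates memberships: `bt a c = indZ (dec c ∈ 𝔄)`. [this work] -/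
theorem bt_eq_indZ {𝔄 : Set (Set ι)} {a : ℕ} (ha : ∀ c, c < 8 → (a.testBit c = true ↔ dec p q r c ∈ 𝔄)) {c : ℕ} (hc : c < 8) :
    (bt a c : ℤ) = indZ (dec p q r c ∈ 𝔄) := by
  unfold bt indZ
  by_cases h : dec p q r c ∈ 𝔄
  · rw [if_pos ((ha c hc).2 h), if_pos h]; rfl
  · have hf : ¬ (a.testBit c = true) := fun ht => h ((ha c hc).1 ht)
    rw [if_neg hf, if_neg h]; rfl

omit [Fintype ι] in
/-- Masks of intersections: `bt (a AND b) c = [c ∈ a][c ∈ b]`. [this work] -/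
theorem bt_and (a b c : ℕ) : bt (a &&& b) c = bt a c * bt b c := by
  unfold bt; rw [Nat.testBit_and]
  rcases Bool.eq_false_or_eq_true (a.testBit c) with h | h <;> rcases Bool.eq_false_or_eq_true (b.testBit c) with h' | h' <;> simp [h, h']

omit [Fintype ι] in
/-- `L27` has no duplicates. [this work] -/
theorem nodup_L27 : L27.Nodup := by decide

omit [Fintype ι] in
/-- On `L27` the third code is `7 − c₁ − c₂ = 7 XOR (c₁ OR c₂)`, and all three codes and their twists are `< 8`. [this work] -/
theorem L27_third (pc : ℕ × ℕ) (h : pc ∈ L27) : 7 - pc.1 - pc.2 = 7 ^^^ (pc.1 ||| pc.2) := by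
  have hall : L27.all (fun pc => decide (7 - pc.1 - pc.2 = 7 ^^^ (pc.1 ||| pc.2))) = true := by decide
  rw [List.all_eq_true] at hall
  exact of_decide_eq_true (hall pc h)

omit [Fintype ι] in
/-- XOR with a code `< 8` stays `< 8`. [this work] -/
theorem xor_lt_eight {c t : ℕ} (hc : c < 8) (ht : t < 8) : c ^^^ t < 8 :=
  Nat.xor_lt_two_pow (n := 3) hc ht

omit [Fintype ι] in
include hd in
/-- Twisted parts of coded patterns are decoded XOR-codes. [this work] -/
theorem qc_dec (τ : Set ι) (c₁ c₂ : ℕ) :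
    qc₁ τ {p, q, r} (dec p q r c₁, dec p q r c₂) = dec p q r (c₁ ^^^ enc p q r τ) ∧
    qc₂ τ {p, q, r} (dec p q r c₁, dec p q r c₂) = dec p q r (c₂ ^^^ enc p q r τ) ∧
    qc₃ τ {p, q, r} (dec p q r c₁, dec p q r c₂) = dec p q r ((7 ^^^ (c₁ ||| c₂)) ^^^ enc p q r τ) := by
  have ht : τ ∩ {p, q, r} = dec p q r (enc p q r τ) := (dec_enc p q r τ).symm
  unfold qc₁ qc₂ qc₃
  refine ⟨?_, ?_, ?_⟩
  · rw [ht, ← dec_xor hd]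
  · rw [ht, ← dec_xor hd]
  · rw [ht, pt₃_dec hd, ← dec_xor hd]

include hd in
/-- **Evaluation of the two-copy pattern form** at coded data: `Σ_P cJ·[qc₂∈𝔄][qc₃∈𝔅] = W⁺ − W⁻`. [this work] -/
theorem sum_cJ_eq (τ : Set ι) {𝔘 𝔄 𝔅 : Set (Set ι)} {u a b : ℕ}
    (hu : ∀ c, c < 8 → (u.testBit c = true ↔ dec p q r c ∈ 𝔘)) (ha : ∀ c, c < 8 → (a.testBit c = true ↔ dec p q r c ∈ 𝔄))
    (hb : ∀ c, c < 8 → (b.testBit c = true ↔ dec p q r c ∈ 𝔅)) :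
    ∑ P ∈ cfgsIn ({p, q, r} : Set ι), cJ τ {p, q, r} 𝔘 P * indZ (qc₂ τ {p, q, r} P ∈ 𝔄 ∧ qc₃ τ {p, q, r} P ∈ 𝔅) =
      (Wp (enc p q r τ) u a b : ℤ) - Wm (enc p q r τ) u a b := by
  rw [sum_cfgsIn_eq_sum_L27 hd]
  unfold Wp Wm
  rw [← List.sum_toFinset _ nodup_L27, ← List.sum_toFinset _ nodup_L27]
  push_cast
  rw [← Finset.sum_sub_distrib]
  refine Finset.sum_congr rfl fun pc hpc => ?_
  have hmem := List.mem_toFinset.1 hpc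
  obtain ⟨h1, h2, _⟩ := mem_L27_iff.1 hmem
  have ht := enc_lt p q r τ
  obtain ⟨e1, e2, e3⟩ := qc_dec hd τ pc.1 pc.2
  have h3 : 7 - pc.1 - pc.2 < 8 := by omega
  rw [L27_third pc hmem] at h3 ⊢
  unfold cJ
  rw [e1, e2, e3, indZ_and, ← bt_eq_indZ hu (xor_lt_eight h1 ht), ← bt_eq_indZ hu (xor_lt_eight h2 ht), ← bt_eq_indZ hu (xor_lt_eight h3 ht),
    ← bt_eq_indZ ha (xor_lt_eight h2 ht), ← bt_eq_indZ hb (xor_lt_eight h3 ht)]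
  ring

include hd in
/-- **Evaluation of the diagonal form**: `Σ_m κ(m)[m∈𝔄][m∈𝔅] = K(κ, a AND b)`. [this work] -/
theorem sum_kappa_eq {𝔄 𝔅 : Set (Set ι)} {a b : ℕ} (ha : ∀ c, c < 8 → (a.testBit c = true ↔ dec p q r c ∈ 𝔄))
    (hb : ∀ c, c < 8 → (b.testBit c = true ↔ dec p q r c ∈ 𝔅)) (κl : List ℕ) :
    ∑ m ∈ subsetsOf ({p, q, r} : Set ι), (κl.getD (enc p q r m) 0 : ℤ) * indZ (m ∈ 𝔄 ∧ m ∈ 𝔅) = (Kd κl (a &&& b) : ℤ) := by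
  rw [sum_subsetsOf_eq_sum_range hd]
  unfold Kd
  rw [← List.sum_toFinset _ (List.nodup_range), List.toFinset_range]
  push_cast
  refine Finset.sum_congr rfl fun c hc => ?_
  have hc8 := Finset.mem_range.1 hc
  rw [enc_dec hd hc8, bt_and, indZ_and, Nat.cast_mul, bt_eq_indZ ha hc8, bt_eq_indZ hb hc8]

include hd in
/-- **Evaluation of the one-copy pattern form**: `Σ_P eJ·[qc₃∈𝔄][qc₃∈𝔅] = Φ⁺ − Φ⁻` at `d = a AND b`. [this work] -/
theorem sum_eJ_eq (τ : Set ι) {𝔘 𝔄 𝔅 : Set (Set ι)} {u a b : ℕ}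
    (hu : ∀ c, c < 8 → (u.testBit c = true ↔ dec p q r c ∈ 𝔘)) (ha : ∀ c, c < 8 → (a.testBit c = true ↔ dec p q r c ∈ 𝔄))
    (hb : ∀ c, c < 8 → (b.testBit c = true ↔ dec p q r c ∈ 𝔅)) :
    ∑ P ∈ cfgsIn ({p, q, r} : Set ι), eJ τ {p, q, r} 𝔘 P * indZ (qc₃ τ {p, q, r} P ∈ 𝔄 ∧ qc₃ τ {p, q, r} P ∈ 𝔅) =
      (Pp (enc p q r τ) u (a &&& b) : ℤ) - Pm (enc p q r τ) u (a &&& b) := by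
  rw [sum_cfgsIn_eq_sum_L27 hd]
  unfold Pp Pm
  rw [← List.sum_toFinset _ nodup_L27, ← List.sum_toFinset _ nodup_L27]
  push_cast
  rw [← Finset.sum_sub_distrib]
  refine Finset.sum_congr rfl fun pc hpc => ?_
  have hmem := List.mem_toFinset.1 hpc
  obtain ⟨h1, h2, _⟩ := mem_L27_iff.1 hmem
  have ht := enc_lt p q r τ
  obtain ⟨e1, e2, e3⟩ := qc_dec hd τ pc.1 pc.2
  have h3 : 7 - pc.1 - pc.2 < 8 := by omega
  rw [L27_third pc hmem] at h3 ⊢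
  unfold eJ
  rw [e1, e3, indZ_and, bt_and, ← bt_eq_indZ hu (xor_lt_eight h1 ht), ← bt_eq_indZ hu (xor_lt_eight h3 ht),
    ← bt_eq_indZ ha (xor_lt_eight h3 ht), ← bt_eq_indZ hb (xor_lt_eight h3 ht)]
  push_cast
  ring

include hd in
/-- **Soundness of the finite check**: a passing `checkOne` row is a pure diagonal certificate. [this work] -/
theorem diagCert_of_checkOne (τ : Set ι) {𝔘 : Set (Set ι)} {u : ℕ} (hu : ∀ c, c < 8 → (u.testBit c = true ↔ dec p q r c ∈ 𝔘))
    {κl : List ℕ} (hchk : checkOne (enc p q r τ) u κl = true) :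
    DiagCert τ ({p, q, r} : Set ι) 𝔘 (fun m => (κl.getD (enc p q r m) 0 : ℤ)) := by
  unfold checkOne at hchk
  rw [Bool.and_eq_true, List.all_eq_true, List.all_eq_true] at hchk
  obtain ⟨hii, hi⟩ := hchk
  refine ⟨fun m _ => Nat.cast_nonneg _, fun 𝔄 𝔅 h𝔄 h𝔅 => ?_, fun 𝔄 𝔅 h𝔄 h𝔅 => ?_⟩
  · obtain ⟨a, ha, hma⟩ := exists_mask (p := p) (q := q) (r := r) 𝔄 h𝔄
    obtain ⟨b, hb, hmb⟩ := exists_mask (p := p) (q := q) (r := r) 𝔅 h𝔅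
    have h := hi a ha
    rw [List.all_eq_true] at h
    have h' : Wp (enc p q r τ) u a b ≤ Wm (enc p q r τ) u a b + Kd κl (a &&& b) := of_decide_eq_true (h b hb)
    rw [sum_cJ_eq hd τ hu hma hmb, sum_kappa_eq hd hma hmb]
    have h'' : (Wp (enc p q r τ) u a b : ℤ) ≤ Wm (enc p q r τ) u a b + Kd κl (a &&& b) := by exact_mod_cast h'
    linarith
  · obtain ⟨a, ha, hma⟩ := exists_mask (p := p) (q := q) (r := r) 𝔄 h𝔄
    obtain ⟨b, hb, hmb⟩ := exists_mask (p := p) (q := q) (r := r) 𝔅 h𝔅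
    have hab : a &&& b ∈ MONO8 := by
      have key : ∀ a ∈ MONO8, ∀ b ∈ MONO8, a &&& b ∈ MONO8 := by decide
      exact key a ha b hb
    have h' : Kd κl (a &&& b) + Pm (enc p q r τ) u (a &&& b) ≤ Pp (enc p q r τ) u (a &&& b) := of_decide_eq_true (hii _ hab)
    rw [sum_eJ_eq hd τ hu hma hmb, sum_kappa_eq hd hma hmb]
    have h'' : (Kd κl (a &&& b) : ℤ) + Pm (enc p q r τ) u (a &&& b) ≤ Pp (enc p q r τ) u (a &&& b) := by exact_mod_cast h'
    linarith

include hd in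
/-- **THE 3-JUNTA THEOREM** (twisted three-partition positivity for every increasing event depending on three coordinates):
for distinct `p, q, r`, every up-set `𝔘` (its trace on `2^{p,q,r}` defines the junta `liftQ {p,q,r} 𝔘 = {x : x ∩ {p,q,r} ∈ 𝔘}`),
every twist `τ` and all up-sets `A, B`: `0 ≤ threePartNT τ (liftQ {p,q,r} 𝔘) A B`. [this work] -/
theorem threePartNT_junta3_nonneg {𝔘 : Set (Set ι)} (h𝔘 : IsUpperSet 𝔘) (τ : Set ι) {A B : Set (Set ι)}
    (hA : IsUpperSet A) (hB : IsUpperSet B) : 0 ≤ threePartNT τ (liftQ ({p, q, r} : Set ι) 𝔘) A B := by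
  obtain ⟨u, hu, hmu⟩ := exists_mask (p := p) (q := q) (r := r) 𝔘 h𝔘
  have hT := checkT_all (enc p q r τ) (enc_lt p q r τ)
  unfold checkT at hT
  rw [Bool.and_eq_true, List.all_eq_true, List.all_eq_true] at hT
  obtain ⟨hall, hcov⟩ := hT
  have hc := hcov u hu
  rw [List.any_eq_true] at hc
  obtain ⟨e, he, hte⟩ := hc
  rw [Bool.and_eq_true, beq_iff_eq, beq_iff_eq] at hte
  have hchk : checkOne e.1 e.2.1 e.2.2 = true := hall e (List.mem_filter.2 ⟨he, by rw [hte.1]; exact beq_self_eq_true _⟩)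
  rw [hte.1, hte.2] at hchk
  exact threePartNT_liftQ_nonneg_of_cert (diagCert_of_checkOne hd τ hmu hchk) hA hB

omit [Fintype ι] in
/-- An event determined by the coordinates `p, q, r` is the junta lift of itself. [this work] -/
theorem eq_liftQ_of_determined {𝒰 : Set (Set ι)} (h : ∀ x, x ∈ 𝒰 ↔ x ∩ {p, q, r} ∈ 𝒰) : 𝒰 = liftQ ({p, q, r} : Set ι) 𝒰 := by
  ext x; rw [mem_liftQ]; exact h x

include hd in
/-- **The 3-junta theorem for an event determined by three coordinates** (first slot). [this work] -/
theorem threePartNT_nonneg_of_determined3 {𝒰 A B : Set (Set ι)} (h𝒰 : IsUpperSet 𝒰) (h : ∀ x, x ∈ 𝒰 ↔ x ∩ {p, q, r} ∈ 𝒰)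
    (τ : Set ι) (hA : IsUpperSet A) (hB : IsUpperSet B) : 0 ≤ threePartNT τ 𝒰 A B := by
  have h0 := threePartNT_junta3_nonneg hd h𝒰 τ hA hB
  rwa [← eq_liftQ_of_determined h] at h0

include hd in
/-- **The 3-junta theorem, any slot**: `N_τ(𝒰, 𝒱, 𝒲) ≥ 0` whenever one of the three increasing events is determined by `{p, q, r}`. [this work] -/
theorem threePartNT_nonneg_of_junta3 (τ : Set ι) {𝒰 𝒱 𝒲 : Set (Set ι)} (h𝒰 : IsUpperSet 𝒰) (h𝒱 : IsUpperSet 𝒱) (h𝒲 : IsUpperSet 𝒲)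
    (h : (∀ x, x ∈ 𝒰 ↔ x ∩ {p, q, r} ∈ 𝒰) ∨ (∀ x, x ∈ 𝒱 ↔ x ∩ {p, q, r} ∈ 𝒱) ∨ (∀ x, x ∈ 𝒲 ↔ x ∩ {p, q, r} ∈ 𝒲)) :
    0 ≤ threePartNT τ 𝒰 𝒱 𝒲 := by
  rcases h with h | h | h
  · exact threePartNT_nonneg_of_determined3 hd h𝒰 h τ h𝒱 h𝒲
  · rw [threePartNT_swap12]; exact threePartNT_nonneg_of_determined3 hd h𝒱 h τ h𝒰 h𝒲
  · rw [threePartNT_swap23, threePartNT_swap12]; exact threePartNT_nonneg_of_determined3 hd h𝒲 h τ h𝒰 h𝒱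

omit [Fintype ι] in
/-- MAJORITY of three coordinates: `MAJ₃(p,q,r) = {x : at least two of p, q, r lie in x}`. [this work] -/
def majFam (p q r : ι) : Set (Set ι) := {x | (p ∈ x ∧ q ∈ x) ∨ (p ∈ x ∧ r ∈ x) ∨ (q ∈ x ∧ r ∈ x)}

omit [Fintype ι] in
/-- `MAJ₃` is increasing. [this work] -/
theorem isUpperSet_majFam (p q r : ι) : IsUpperSet (majFam p q r) := by
  intro x y hxy hx
  rcases hx with ⟨h1, h2⟩ | ⟨h1, h2⟩ | ⟨h1, h2⟩
  · exact Or.inl ⟨hxy h1, hxy h2⟩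
  · exact Or.inr (Or.inl ⟨hxy h1, hxy h2⟩)
  · exact Or.inr (Or.inr ⟨hxy h1, hxy h2⟩)

omit [Fintype ι] in
/-- `MAJ₃(p,q,r)` is determined by `{p, q, r}`. [this work] -/
theorem majFam_determined (p q r : ι) (x : Set ι) : x ∈ majFam p q r ↔ x ∩ {p, q, r} ∈ majFam p q r := by
  simp only [majFam, Set.mem_setOf_eq, Set.mem_inter_iff, Set.mem_insert_iff, Set.mem_singleton_iff, true_or, or_true, and_true]

include hd in
/-- **Example — MAJORITY OF THREE** (neither a disjunction, a conjunction, nor nested with arbitrary events): for every twist and all increasing `A, B`,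
`N_τ(MAJ₃(p,q,r); A, B) ≥ 0`. [this work] -/
theorem threePartNT_maj3_nonneg (τ : Set ι) {A B : Set (Set ι)} (hA : IsUpperSet A) (hB : IsUpperSet B) :
    0 ≤ threePartNT τ (majFam p q r) A B :=
  threePartNT_nonneg_of_determined3 hd (isUpperSet_majFam p q r) (majFam_determined p q r) τ hA hB

end Sound

end Summit.CriticalPhenomena.PercolationContinuityZ3.Theorems.ThreePartition

end
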